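import Literature.AlgebraicGeometry.Resolution.StrictTransformOpenImmersion
import Literature.AlgebraicGeometry.Resolution.StrictTransformIsBlowup
import Literature.AlgebraicGeometry.Resolution.BlowupsCompositionFiniteType
import Literature.AlgebraicGeometry.Morphisms.IsoOverOpen
import HarnessLib

/-!
# A proper modification is dominated by an admissible blowing up (Stacks 081T), and two
# compactifications have a common admissible blowing up (Conrad 2007, Thm. 2.11 / Rem. 2.12)

Topic: `Literature/AlgebraicGeometry/Resolution`. Both results are consequences of Stacks 081S
(`stacks081S_of_stacks081R`, file `StrictTransformOpenImmersion.lean`), hence of Raynaud–Gruson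
flattening by blowing up (the named fact `Stacks081R`, `StrictTransformFlattening.lean`), which
enters every statement below as the hypothesis `(h081R : Stacks081R)` and is the ONLY
undischarged input.

* `isIso_blowupStrictTransformMap_of_stacks081R` — **Stacks, Tag 081T (More on Flatness,
  Lemma 38.31.4)**: "Let `φ : X → S` be a proper morphism with `S` quasi-compact and
  quasi-separated. Let `U ⊂ S` be a quasi-compact open such that `φ⁻¹U → U` is an isomorphism.
  Then there exists a `U`-admissible blowup `S' → S` which dominates `X`", in the sharper form
  its proof gives: for the `U`-admissible blowing up `b : S' → S` of Tag 081S (centre `𝓘` of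
  finite type with `V(𝓘) = S ∖ U`), the strict transform `X' → S'` of `φ` is an ISOMORPHISM
  (printed proof: "Since `X' → S'` is proper, and `U ⊂ S'` is dense, we see that `X' = S'`").
* `exists_isBlowup_dominating_of_stacks081R` — the same packaged with Stacks, Tag 080E
  (`isBlowup_blowupStrictTransform`: the strict transform is the blowing up of `X` in `φ⁻¹𝓘 𝒪_X`):
  there is `r : S' → X` with `r ≫ φ = b` which is itself the blowing up of `X` in `φ⁻¹𝓘 𝒪_X` —
  "a proper map which is an isomorphism over `U` is birational iff source and target admit a
  common `U`-admissible blow-up" (Conrad 2007, Thm. 2.11, whose proof is the same argument: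
  "since `f` is proper it follows that the dominant open immersion
  `j : Bl_{𝓘·𝒪_{X'}}(X') → Bl_𝓘(X)` over `f` is proper, hence an isomorphism").
* `eq_of_comp_eq_of_isIso_morphismRestrict` — two morphisms into `Z` which agree after
  `p : Z → Y` and land over an open over which `p` is an isomorphism are equal.
* `exists_common_admissible_blowup_of_stacks081R` — **two compactifications of the same scheme
  have a common admissible blowing up** (Conrad 2007, Remark 2.12 "any two proper birational maps
  from a common source become isomorphisms after suitable blow-ups", and the special case of
  Cor. 2.10 spelled out before Thm. 2.11: "`X₁` and `X₂` have a common `U`-admissible blow-up"):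
  for open immersions `eᵢ : V → Yᵢ` of a quasi-compact `V` into proper `B`-schemes
  `qᵢ : Yᵢ → B` (`B` quasi-compact and quasi-separated) with `e₁ ≫ q₁ = e₂ ≫ q₂`, there are a
  scheme `T`, an open immersion `e : V → T` and morphisms `tᵢ : T → Yᵢ` with `e ≫ tᵢ = eᵢ`,
  `t₁ ≫ q₁ = t₂ ≫ q₂`, such that `tᵢ` is the blowing up of `Yᵢ` in an ideal sheaf `𝓚ᵢ` of
  finite type whose support does not meet `eᵢ(V)` (an `eᵢ(V)`-admissible blowing up, Stacks
  080K). Proof (Conrad, Rem. 2.12, with Tag 081T for Thm. 2.11 and Tag 080L for Lemma 1.2): let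
  `Z` be the scheme-theoretic image of `(e₁, e₂) : V → Y₁ ×_B Y₂`; its projections
  `pᵢ : Z → Yᵢ` are proper and isomorphisms over `eᵢ(V)` (Stacks 01RH,
  `Morphisms.GraphClosure.isIso_morphismRestrict`). By 081T, `p₁` is dominated by an
  `e₁(V)`-admissible blowing up `b₁ : T₁ → Y₁`, through `r₁ : T₁ → Z`, the blowing up of `Z` in
  the pulled-back centre; the proper `r₁ ≫ p₂ : T₁ → Y₂` is again an isomorphism over `e₂(V)`,
  so by 081T it is dominated by an `e₂(V)`-admissible blowing up `t₂ = b₂ : T → Y₂` through the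
  blowing up `r₂ : T → T₁` in the pulled-back centre, and `t₁ = r₂ ≫ b₁` is an
  `e₁(V)`-admissible blowing up by Tag 080L (`IsBlowup.exists_isBlowup_comp_admissible`).

This is the engine of the Zariski-local-on-the-base step of Nagata's compactification theorem
in `Morphisms/CompactificationBaseGluing.lean` (gluing compactifications given over the members
of an open cover of the base after refining them by admissible blowing ups).

## References

* The Stacks Project, Tag 081T (More on Flatness, Lemma 38.31.4), Tag 081S, Tag 080E, Tag 080L,
  Tag 01RH. [StacksProject]
* B. Conrad, *Deligne's notes on Nagata compactifications*, J. Ramanujan Math. Soc. 22 (2007),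
  Thm. 2.11, Remark 2.12, Cor. 2.10, Lemma 1.2. [Conrad2007]
* M. Raynaud, L. Gruson, *Critères de platitude et de projectivité*, Invent. Math. 13 (1971),
  Première partie, Thm. 5.2.2, Lemme 5.1.4. [RaynaudGruson1971]
-/

noncomputable section

-- Mathlib's pull-back API is stated through `abbrev`s over `limit`; as in Mathlib's own
-- algebraic-geometry files we let `simp`/unification see through them.
set_option backward.isDefEq.respectTransparency false

open CategoryTheory CategoryTheory.Limits AlgebraicGeometry TopologicalSpace

namespace Literature.AlgebraicGeometry.Resolution

universe u

open Literature.AlgebraicGeometry.Morphisms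

/-! ## Stacks 081T: a proper modification is dominated by an admissible blowing up -/

/-- **Stacks, Tag 081T (for `φ` proper the strict transform of Tag 081S is an isomorphism).**
Let `S` be quasi-compact and quasi-separated, `φ : X → S` proper and `U ⊆ S` a quasi-compact
open over which `φ` is an isomorphism. Then for the `U`-admissible blowing up `b : S' → S` of
Tag 081S (in a centre `𝓘` of finite type with `V(𝓘) = S ∖ U`) the strict transform `X' → S'` is
an isomorphism: it is an open immersion (081S) and proper (a closed subscheme of `X ×_S S'`,
proper over `S'`), so its image is closed and open, and it contains the schematically dense
open `b⁻¹U = S' ∖ E` (over which `X' → S'` is an isomorphism); hence it is surjective.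
Conditional on `Stacks081R`. [cite: StacksProject, Tag 081T] -/
theorem isIso_blowupStrictTransformMap_of_stacks081R (h081R : Stacks081R.{u}) {X S : Scheme.{u}}
    (φ : X ⟶ S) [CompactSpace S] [QuasiSeparatedSpace S] [IsProper φ] (U : S.Opens)
    (hU : IsCompact (U : Set S)) [IsIso (φ ∣_ U)] :
    ∃ (I : S.IdealSheafData) (S' : Scheme.{u}) (b : S' ⟶ S),
      (∀ W : S.affineOpens, (I.ideal W).FG) ∧ (I.support : Set S) = (U : Set S)ᶜ ∧
      IsBlowup b I ∧ IsIso (blowupStrictTransformMap φ b I) := by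
  obtain ⟨I, S', b, hfg, hsupp, hb, hopen⟩ := stacks081S_of_stacks081R h081R φ U hU
  refine ⟨I, S', b, hfg, hsupp, hb, ?_⟩
  haveI := hopen
  -- `X' → S'` is proper
  haveI : IsProper (blowupStrictTransformMap φ b I) := by
    rw [← blowupStrictTransformι_snd]
    infer_instance
  -- its (closed, open) image contains the dense open `b⁻¹U = S' ∖ E`
  obtain rfl : U = centreCompl I := (centreCompl_eq_of_support_eq hsupp).symm
  haveI := isIso_blowupStrictTransformMap_morphismRestrict φ b I hb.isEffectiveCartier
  haveI hqc := hb.isEffectiveCartier.quasiCompact_ι_centreCompl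
  haveI hdom := hb.isEffectiveCartier.isSchemeTheoreticallyDominant_ι_centreCompl
  have hdense : Dense ((centreCompl (I.comap b) : S'.Opens) : Set S') := by
    rw [← Scheme.Opens.range_ι]
    exact (centreCompl (I.comap b)).ι.denseRange
  have hsub : ((centreCompl (I.comap b) : S'.Opens) : Set S') ⊆
      Set.range (blowupStrictTransformMap φ b I) := fun y hy => by
    rw [← preimage_centreCompl] at hy
    obtain ⟨x, hx⟩ := (Scheme.homeoOfIso (asIso ((blowupStrictTransformMap φ b I) ∣_
      (b ⁻¹ᵁ centreCompl I)))).surjective ⟨y, hy⟩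
    refine ⟨x.1, ?_⟩
    have := congrArg Subtype.val hx
    simpa only [Scheme.homeoOfIso_apply, asIso_hom, morphismRestrict_base_coe] using this
  have hclosed : IsClosed (Set.range (blowupStrictTransformMap φ b I)) :=
    (blowupStrictTransformMap φ b I).isClosedMap.isClosed_range
  haveI : Surjective (blowupStrictTransformMap φ b I) := ⟨by
    rw [← Set.range_eq_univ, ← hclosed.closure_eq]
    exact (hdense.mono hsub).closure_eq⟩
  exact (isIso_iff_isOpenImmersion_and_epi_base (f := blowupStrictTransformMap φ b I)).mpr
    ⟨inferInstance, (TopCat.epi_iff_surjective _).mpr (blowupStrictTransformMap φ b I).surjective⟩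

/-- **Stacks 081T with Tag 080E: a proper modification is dominated by a common admissible
blowing up.** In the situation of `isIso_blowupStrictTransformMap_of_stacks081R` there is,
besides the `U`-admissible blowing up `b : S' → S` in `𝓘`, a morphism `r : S' → X` with
`r ≫ φ = b` which is the blowing up of `X` in `φ⁻¹𝓘 𝒪_X` (namely the inverse of the strict
transform isomorphism followed by `X' ⊆ X ×_S S' → X`, a blowing up in `φ⁻¹𝓘 𝒪_X` by Tag 080E).
Conditional on `Stacks081R`. [cite: StacksProject, Tag 081T; Conrad2007, Thm. 2.11] -/
theorem exists_isBlowup_dominating_of_stacks081R (h081R : Stacks081R.{u}) {X S : Scheme.{u}}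
    (φ : X ⟶ S) [CompactSpace S] [QuasiSeparatedSpace S] [IsProper φ] (U : S.Opens)
    (hU : IsCompact (U : Set S)) [IsIso (φ ∣_ U)] :
    ∃ (I : S.IdealSheafData) (S' : Scheme.{u}) (b : S' ⟶ S) (r : S' ⟶ X),
      (∀ W : S.affineOpens, (I.ideal W).FG) ∧ (I.support : Set S) = (U : Set S)ᶜ ∧
      IsBlowup b I ∧ r ≫ φ = b ∧ IsBlowup r (I.comap φ) := by
  obtain ⟨I, S', b, hfg, hsupp, hb, hiso⟩ :=
    isIso_blowupStrictTransformMap_of_stacks081R h081R φ U hU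
  haveI := hiso
  refine ⟨I, S', b, inv (blowupStrictTransformMap φ b I) ≫ blowupStrictTransformι φ b I ≫
    pullback.fst φ b, hfg, hsupp, hb, ?_, ?_⟩
  · rw [Category.assoc, Category.assoc, pullback.condition, ← Category.assoc _ _ b,
      blowupStrictTransformι_snd, IsIso.inv_hom_id_assoc]
  · exact (isBlowup_blowupStrictTransform φ b I hb).iso_comp
      (asIso (blowupStrictTransformMap φ b I)).symm

/-! ## Morphisms agreeing over an open over which the target map is an isomorphism -/

/-- **Two morphisms `α, β : A → Z` with `α ≫ p = β ≫ p` landing over an open `U ⊆ Y` over which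
`p : Z → Y` is an isomorphism coincide**: both factor through `p⁻¹U`, on which `p` is a
monomorphism. [folklore] -/
theorem eq_of_comp_eq_of_isIso_morphismRestrict {A Z Y : Scheme.{u}} (p : Z ⟶ Y) (U : Y.Opens)
    [IsIso (p ∣_ U)] {α β : A ⟶ Z} (h : α ≫ p = β ≫ p)
    (hU : ∀ a : A, p (α a) ∈ U) : α = β := by
  have hα : Set.range α ⊆ Set.range (p ⁻¹ᵁ U).ι := by
    rw [Scheme.Opens.range_ι]
    rintro _ ⟨a, rfl⟩
    exact hU a
  have hβ : Set.range β ⊆ Set.range (p ⁻¹ᵁ U).ι := by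
    rw [Scheme.Opens.range_ι]
    rintro _ ⟨a, rfl⟩
    show p (β a) ∈ U
    rw [← Scheme.Hom.comp_apply, ← h, Scheme.Hom.comp_apply]
    exact hU a
  have key : IsOpenImmersion.lift (p ⁻¹ᵁ U).ι α hα = IsOpenImmersion.lift (p ⁻¹ᵁ U).ι β hβ := by
    rw [← cancel_mono (p ∣_ U), ← cancel_mono U.ι, Category.assoc, Category.assoc,
      morphismRestrict_ι, IsOpenImmersion.lift_fac_assoc, IsOpenImmersion.lift_fac_assoc, h]
  rw [← IsOpenImmersion.lift_fac (p ⁻¹ᵁ U).ι α hα, ← IsOpenImmersion.lift_fac (p ⁻¹ᵁ U).ι β hβ,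
    key]

/-! ## Two compactifications have a common admissible blowing up -/

/-- **Two compactifications of a quasi-compact scheme have a common admissible blowing up**
(Conrad 2007, Remark 2.12 and the special case of Cor. 2.10 before Thm. 2.11; here from Stacks
081T twice and 080L once, see the module docstring). For open immersions `eᵢ : V → Yᵢ` into
proper `B`-schemes `qᵢ : Yᵢ → B`, `B` quasi-compact and quasi-separated, `V` quasi-compact,
with `e₁ ≫ q₁ = e₂ ≫ q₂`: there are `T`, an open immersion `e : V → T` and `tᵢ : T → Yᵢ` with
`e ≫ tᵢ = eᵢ` and `t₁ ≫ q₁ = t₂ ≫ q₂`, where `tᵢ` is the blowing up of `Yᵢ` in an ideal sheaf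
`𝓚ᵢ` of finite type whose support does not meet `eᵢ(V)`. Conditional on `Stacks081R`.
[cite: Conrad2007, Remark 2.12; StacksProject, Tag 081T] -/
theorem exists_common_admissible_blowup_of_stacks081R (h081R : Stacks081R.{u})
    {V Y₁ Y₂ B : Scheme.{u}} [CompactSpace B] [QuasiSeparatedSpace B] [CompactSpace V]
    (e₁ : V ⟶ Y₁) (q₁ : Y₁ ⟶ B) (e₂ : V ⟶ Y₂) (q₂ : Y₂ ⟶ B)
    [IsOpenImmersion e₁] [IsOpenImmersion e₂] [IsProper q₁] [IsProper q₂]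
    (h : e₁ ≫ q₁ = e₂ ≫ q₂) :
    ∃ (T : Scheme.{u}) (e : V ⟶ T) (t₁ : T ⟶ Y₁) (t₂ : T ⟶ Y₂)
      (K₁ : Y₁.IdealSheafData) (K₂ : Y₂.IdealSheafData),
      IsOpenImmersion e ∧ e ≫ t₁ = e₁ ∧ e ≫ t₂ = e₂ ∧ t₁ ≫ q₁ = t₂ ≫ q₂ ∧
      (∀ W : Y₁.affineOpens, (K₁.ideal W).FG) ∧
      Disjoint (e₁.opensRange : Set Y₁) (K₁.support : Set Y₁) ∧ IsBlowup t₁ K₁ ∧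
      (∀ W : Y₂.affineOpens, (K₂.ideal W).FG) ∧
      Disjoint (e₂.opensRange : Set Y₂) (K₂.support : Set Y₂) ∧ IsBlowup t₂ K₂ := by
  -- `Y₁`, `Y₂` are quasi-compact and quasi-separated
  haveI : CompactSpace Y₁ := QuasiCompact.compactSpace_of_compactSpace q₁
  haveI : CompactSpace Y₂ := QuasiCompact.compactSpace_of_compactSpace q₂
  haveI : QuasiSeparatedSpace Y₁ := quasiSeparatedSpace_of_quasiSeparated q₁
  haveI : QuasiSeparatedSpace Y₂ := quasiSeparatedSpace_of_quasiSeparated q₂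
  /- (1) the scheme-theoretic image `Z` of `(e₁, e₂) : V → Y₁ ×_B Y₂`; its projections `pᵢ` are
  proper and isomorphisms over `eᵢ(V)` -/
  set m : V ⟶ pullback q₁ q₂ := pullback.lift e₁ e₂ h with hm
  have hm₁ : m ≫ pullback.fst q₁ q₂ = e₁ := pullback.lift_fst _ _ _
  have hm₂ : m ≫ pullback.snd q₁ q₂ = e₂ := pullback.lift_snd _ _ _
  haveI : QuasiSeparatedSpace ↑(pullback q₁ q₂) :=
    quasiSeparatedSpace_of_quasiSeparated (pullback.fst q₁ q₂ ≫ q₁)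
  set p₁ : m.image ⟶ Y₁ := m.imageι ≫ pullback.fst q₁ q₂ with hp₁
  set p₂ : m.image ⟶ Y₂ := m.imageι ≫ pullback.snd q₁ q₂ with hp₂
  have hp₁₂ : p₁ ≫ q₁ = p₂ ≫ q₂ := by
    rw [hp₁, hp₂, Category.assoc, Category.assoc, pullback.condition]
  have htp₁ : m.toImage ≫ p₁ = e₁ := by rw [hp₁, Scheme.Hom.toImage_imageι_assoc, hm₁]
  have htp₂ : m.toImage ≫ p₂ = e₂ := by rw [hp₂, Scheme.Hom.toImage_imageι_assoc, hm₂]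
  haveI hiso₁ : IsIso (p₁ ∣_ e₁.opensRange) :=
    GraphClosure.isIso_morphismRestrict e₁ (pullback.fst q₁ q₂) m hm₁
  haveI hiso₂ : IsIso (p₂ ∣_ e₂.opensRange) :=
    GraphClosure.isIso_morphismRestrict e₂ (pullback.snd q₁ q₂) m hm₂
  obtain ⟨-, hrange₁⟩ :=
    GraphClosure.isOpenImmersion_toImage_and_range e₁ (pullback.fst q₁ q₂) m hm₁
  obtain ⟨-, hrange₂⟩ :=
    GraphClosure.isOpenImmersion_toImage_and_range e₂ (pullback.snd q₁ q₂) m hm₂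
  haveI : IsProper p₁ := by rw [hp₁]; infer_instance
  haveI : IsProper p₂ := by rw [hp₂]; infer_instance
  haveI : CompactSpace ↑m.image := QuasiCompact.compactSpace_of_compactSpace p₁
  haveI : QuasiSeparatedSpace ↑m.image := quasiSeparatedSpace_of_quasiSeparated p₁
  have hU₁ : IsCompact (e₁.opensRange : Set Y₁) := isCompact_range e₁.continuous
  have hU₂ : IsCompact (e₂.opensRange : Set Y₂) := isCompact_range e₂.continuous
  -- `p₂⁻¹(e₂ V) ⊆ p₁⁻¹(e₁ V)` (both are `V ⊆ Z`)
  have hle : ∀ z : ↑m.image, p₂ z ∈ e₂.opensRange → p₁ z ∈ e₁.opensRange := by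
    intro z hz
    have hz' : z ∈ Set.range m.toImage := by
      rw [hrange₂]
      exact hz
    obtain ⟨x, rfl⟩ := hz'
    exact ⟨x, by rw [← Scheme.Hom.comp_apply, htp₁]⟩
  /- (2) Stacks 081T for `p₁`: an `e₁(V)`-admissible blowing up `b₁ : T₁ → Y₁` dominating `Z`
  through the blowing up `r₁ : T₁ → Z` in the pulled-back centre -/
  obtain ⟨I₁, T₁, b₁, r₁, hI₁fg, hI₁supp, hb₁, hr₁p, hr₁⟩ :=
    exists_isBlowup_dominating_of_stacks081R h081R p₁ e₁.opensRange hU₁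
  haveI : IsProper b₁ := IsBlowup.isProper_of_fg hI₁fg hb₁
  haveI : IsProper r₁ := IsBlowup.isProper_of_fg (fg_ideal_comap p₁ hI₁fg) hr₁
  haveI : CompactSpace T₁ := QuasiCompact.compactSpace_of_compactSpace b₁
  haveI : QuasiSeparatedSpace T₁ := quasiSeparatedSpace_of_quasiSeparated b₁
  -- the proper `w = r₁ ≫ p₂ : T₁ → Y₂` is an isomorphism over `e₂(V)`
  haveI : IsIso (r₁ ∣_ (p₂ ⁻¹ᵁ e₂.opensRange)) := by
    refine hr₁.isIso_morphismRestrict ?_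
    rw [Scheme.IdealSheafData.support_comap]
    refine Set.disjoint_left.mpr fun z hz hzI => ?_
    have hzI' : p₁ z ∈ (I₁.support : Set Y₁) := hzI
    rw [hI₁supp] at hzI'
    exact hzI' (hle z hz)
  haveI : IsIso ((r₁ ≫ p₂) ∣_ e₂.opensRange) := isIso_morphismRestrict_comp r₁ p₂ e₂.opensRange
  /- (3) Stacks 081T for `w`: an `e₂(V)`-admissible blowing up `b₂ : T → Y₂` dominating `T₁`
  through the blowing up `r₂ : T → T₁` in the pulled-back centre -/
  obtain ⟨I₂, T, b₂, r₂, hI₂fg, hI₂supp, hb₂, hr₂w, hr₂⟩ :=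
    exists_isBlowup_dominating_of_stacks081R h081R (r₁ ≫ p₂) e₂.opensRange hU₂
  /- (4) `t₁ = r₂ ≫ b₁` is an `e₁(V)`-admissible blowing up (Stacks 080L) -/
  have hdisj₁ : Disjoint (e₁.opensRange : Set Y₁) (I₁.support : Set Y₁) := by
    rw [hI₁supp]
    exact disjoint_compl_right
  have hdisj₂ : Disjoint (e₂.opensRange : Set Y₂) (I₂.support : Set Y₂) := by
    rw [hI₂supp]
    exact disjoint_compl_right
  have hdisj₂' : Disjoint ((b₁ ⁻¹ᵁ e₁.opensRange : T₁.Opens) : Set T₁)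
      ((I₂.comap (r₁ ≫ p₂)).support : Set T₁) := by
    rw [Scheme.IdealSheafData.support_comap]
    refine Set.disjoint_left.mpr fun t ht htI => ?_
    have htI' : (r₁ ≫ p₂) t ∈ (I₂.support : Set Y₂) := htI
    rw [hI₂supp] at htI'
    apply htI'
    -- `b₁ t ∈ e₁(V)` forces `r₁ t ∈ V ⊆ Z`, whence `p₂ (r₁ t) ∈ e₂(V)`
    have h1 : p₁ (r₁ t) ∈ e₁.opensRange := by
      rw [← Scheme.Hom.comp_apply, hr₁p]
      exact ht
    have h2 : r₁ t ∈ Set.range m.toImage := by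
      rw [hrange₁]
      exact h1
    obtain ⟨x, hx⟩ := h2
    refine ⟨x, ?_⟩
    rw [Scheme.Hom.comp_apply, ← hx, ← Scheme.Hom.comp_apply, htp₂]
  obtain ⟨K₁, hK₁fg, hK₁disj, hK₁⟩ := hb₁.exists_isBlowup_comp_admissible e₁.opensRange hI₁fg
    hdisj₁ hr₂ (fg_ideal_comap (r₁ ≫ p₂) hI₂fg) hdisj₂'
  /- (5) the open immersion `e : V → T`: lift `e₂` through `b₂`, an isomorphism over `e₂(V)` -/
  haveI : IsIso (b₂ ∣_ e₂.opensRange) := hb₂.isIso_morphismRestrict hdisj₂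
  obtain ⟨e, he₂, hoe⟩ : ∃ e : V ⟶ T, e ≫ b₂ = e₂ ∧ IsOpenImmersion e :=
    ⟨e₂.isoOpensRange.hom ≫ inv (b₂ ∣_ e₂.opensRange) ≫ (b₂ ⁻¹ᵁ e₂.opensRange).ι, by
      rw [Category.assoc, Category.assoc, ← morphismRestrict_ι, IsIso.inv_hom_id_assoc,
        Scheme.Hom.isoOpensRange_hom_ι], inferInstance⟩
  -- `e ≫ r₂ ≫ r₁` is the corestriction `V → Z` (both agree after `p₂`, over `e₂(V)`)
  have hcomp : (e ≫ r₂ ≫ r₁) ≫ p₂ = m.toImage ≫ p₂ := by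
    simp only [Category.assoc]
    rw [hr₂w, he₂, htp₂]
  have key : e ≫ r₂ ≫ r₁ = m.toImage := by
    refine eq_of_comp_eq_of_isIso_morphismRestrict p₂ e₂.opensRange hcomp fun x => ?_
    rw [← Scheme.Hom.comp_apply, hcomp, htp₂]
    exact ⟨x, rfl⟩
  refine ⟨T, e, r₂ ≫ b₁, b₂, K₁, I₂, hoe, ?_, he₂, ?_, hK₁fg, hK₁disj, hK₁, hI₂fg,
    hdisj₂, hb₂⟩
  · -- `e ≫ r₂ ≫ b₁ = e ≫ r₂ ≫ r₁ ≫ p₁ = V → Z → Y₁ = e₁`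
    rw [← hr₁p, ← htp₁, ← key]
    simp only [Category.assoc]
  · -- `(r₂ ≫ b₁) ≫ q₁ = r₂ ≫ r₁ ≫ p₁ ≫ q₁ = r₂ ≫ r₁ ≫ p₂ ≫ q₂ = b₂ ≫ q₂`
    rw [Category.assoc, ← hr₁p, Category.assoc, hp₁₂, ← hr₂w]
    simp only [Category.assoc]

end Literature.AlgebraicGeometry.Resolution

end
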